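import Literature.AlgebraicGeometry.HodgeTheory.DivisorLefschetzGroup
import Literature.AlgebraicGeometry.Milne1999.LefschetzGroupProducts
import Literature.AlgebraicGeometry.Milne1999.DivisorClassesSymmetricCentralizer
import Literature.AlgebraicGeometry.Milne1999.LefschetzCentraliserRosatiInvolution
import HarnessLib

/-!
# Moonen–Zarhin's divisor algebra `B` of a self-product: `B(A × A) ⊗ ℂ = End⁰(A × A) ⊗ ℂ`, hence
# `G_div(A × A) = S(A × A)` («if `m ≥ 2` … then we simply have `Δ = D`»), on the carrier

Layer `Literature/AlgebraicGeometry/HodgeTheory`; THEOREMS ONLY (no definition, no named fact; D-0026 net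
debt 0). Sequel of the seat's `DivisorLefschetzGroup` (`symmetricPullbackSpan A h = S_λ ⊗ ℂ`,
`divisorLefschetzGroup A h = G_div(X)(ℂ)`, `divisorLefschetzGroup_eq_unitaryCentralizerGroup_of_forall_mem_adjoin`)
and, BY NAME, of the lane's `Milne1999/LefschetzGroupProducts` (the product polarization class
`prodPolarizationClass A B h_A h_B = pr_A^* h_A + pr_B^* h_B` and the block Gram formula
`polarizationPairingOne_prod_add_add`), `Milne1999/LefschetzCentraliserProducts` (Künneth in degree one with
the sections `(𝟙, 0)^*`, `(0, 𝟙)^*`) and `Milne1999/DivisorClassesSymmetricCentralizer` (`E'' = End⁰(A) ⊗ ℂ` is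
`†`-stable: `rightAdjoint_mem_bicommutant`).

## The print

B. J. J. Moonen, Yu. G. Zarhin, *Weil classes on abelian varieties*, J. reine angew. Math. **496** (1998)
83–92 = arXiv:alg-geom/9612017 [MoonenZarhin1998WeilClasses], §1 (held text `paper:arxiv-alg-geom_9612017`,
chunks p0002–p0003).  `X = Y^m`, `Y` simple, `D = End⁰(Y)`; `S_λ ⊆ End⁰(X) ≅ M_m(D)` the Rosati-symmetric
elements, `B` the `ℚ`-subalgebra they generate, `G_div(X) := Gl_B(V) ∩ SP(V, φ)`.  VERBATIM (chunk p0002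
L68–L80): «From Table 1 we see that in all cases there is a simple `ℚ`-subalgebra `Δ ⊆ D = End⁰(Y)` such
that `∗` restricts to a positive involution on `Δ`, and such that `G_div(X)` is the centralizer of `Δ` in
`SP(V_Y, φ_Y)`, embedded diagonally into `SP(V, φ)`. (In fact, if `m ≥ 2` or if `X` is of type 1 or 2, then we
simply have `Δ = D`. If `m = 1` then `Δ = B`.)»; and in the proof of Criterion (crit2), type 3 with `m ≥ 2`
(chunk p0003): «We have `B = Mat_m(D)`, hence `F ⊆ B`.»  («With `End⁰(X) = Mat_m(D)`, the Rosati involutions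
`∗` and `†` are related by `α† = (α*_{ji})` for `α = (α_{ij}) ∈ Mat_m(D)`», chunk p0002.)

So for `m ≥ 2` the divisor algebra is EVERYTHING, `B = Mat_m(D) = End⁰(X)`, and `G_div(X)` is the
centralizer of all of `End⁰(X)` in `Sp(V, φ)` — Milne's group `S(X)` [Milne 1999, §1 p. 644].  The mechanism
(Table 1): `S_λ(Y^m)` contains the `†`-hermitian matrices `(α_{ij})`, `α_{ji} = α*_{ij}`, in particular the
diagonal idempotents `E_{ii}`, the transposition `E_{12} + E_{21}` and `E_{12}(d) + E_{21}(d*)` for every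
`d ∈ D`; and `(E_{12}(d) + E_{21}(d*)) · E_{22} · (E_{12} + E_{21}) = E_{11}(d)`, so the algebra generated by
`S_λ` contains every matrix unit `E_{ij}(d)`.

## What is proved (the case `m = 2`, on the carrier; `A` is ANY complex abelian variety, not only simple)

Throughout `X = A × A` (`A.prod A`), `H = pr₁^* h + pr₂^* h = prodPolarizationClass A A h h`, and on
`H¹(X(ℂ); ℂ) = pr₁^* H¹(A) ⊕ pr₂^* H¹(A)` the block operators `pr_k^* ∘ T ∘ ι_j^*` (`ι₁ = (𝟙, 0)`,
`ι₂ = (0, 𝟙)`, `T ∈ End_ℂ H¹(A(ℂ); ℂ)`), the carrier form of the matrix units `E_{kj}(T)`.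

* §1 `pullbackOne_prod_apply_eq_sum` — every pull-back `ψ^*`, `ψ ∈ End(A × A)`, is the sum of its four
  blocks `pr_k^* ∘ (ι_k ≫ ψ ≫ pr_j)^* ∘ ι_j^*` (Künneth in degree one; «`V(A₁ × A₂) = V(A₁) ⊕ V(A₂)`»,
  «`End⁰(X) = Mat_m(D)`»).
* §2 `polarizationPairingOne_prodSelf_eq` — the pairing of `H` through the REDUCED pairing
  `q(x, y) = Q_h(ι₁^*x, ι₁^*y) + Q_h(ι₂^*x, ι₂^*y)`:
  `Q_H(x, y) = C(2g−1, g−1) · pr₁^*(h^g) ⌣ pr₂^*(q(x, y))` (`g = dim A > 0`, `h^g ≠ 0`; the block Gram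
  formula, `C(2g−1, g−1) = C(2g−1, g)`, and the top line `H^{2g}(A(ℂ); ℂ) = ℂ · h^g`, which gives
  `pr₁^* z ⌣ pr₂^* h^g = pr₁^* h^g ⌣ pr₂^* z`); hence `q`-self-adjoint ⟹ `Q_H`-self-adjoint
  (`polarizationPairingOne_prod_comm_of_reduced`).
* §3 `exists_adjoint_mem_span_pullbackOne` — for `h ∈ B¹(A) ⊗ ℂ` with `Q_h` non-degenerate, every
  `T ∈ End⁰(A) ⊗ ℂ` (the `ℂ`-span of the pull-backs) has a `Q_h`-adjoint `T†` IN `End⁰(A) ⊗ ℂ` (the Rosati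
  involution; the lane's `Milne1999.rightAdjoint_mem_bicommutant`).
* §4 the `†`-hermitian elements of `S_λ(A × A) ⊗ ℂ = symmetricPullbackSpan (A.prod A) H`: the projectors
  `(pr₁ ≫ ι₁)^*`, `(pr₂ ≫ ι₂)^*` (`pullbackOne_fst_inl_mem_symmetricPullbackSpan_prod`, `…snd_inr…`), the
  transposition `(pr₁ ≫ ι₂)^* + (pr₂ ≫ ι₁)^*` (`swap_mem_symmetricPullbackSpan_prod`) and
  `pr₁^* ∘ T ∘ ι₂^* + pr₂^* ∘ T† ∘ ι₁^*` (`hermitian_mem_symmetricPullbackSpan_prod`).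
* §5 **`pullbackOne_prod_mem_adjoin_symmetricPullbackSpan`** — every `ψ^*`, `ψ ∈ End(A × A)`, lies in
  `B ⊗ ℂ = Algebra.adjoin ℂ (S_λ(A × A) ⊗ ℂ)` (all four blocks `pr_k^* ∘ T ∘ ι_j^*`, `T ∈ End⁰(A) ⊗ ℂ`, do:
  `block_mem_adjoin_symmetricPullbackSpan_prod`); **`adjoin_symmetricPullbackSpan_prod_eq_span`** —
  «`B = Mat_m(D)`»: `B ⊗ ℂ = End⁰(A × A) ⊗ ℂ`, the `ℂ`-span of the pull-backs, as subspaces of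
  `End_ℂ H¹((A × A)(ℂ); ℂ)`; **`divisorLefschetzGroup_prod_eq_unitaryCentralizerGroup`** —
  «`G_div(X)` is the centralizer of `Δ = D`»: `G_div(A × A)(H)(ℂ) = S(A × A)(H)(ℂ) = unitaryCentralizerGroup (A.prod A) H`
  (membership form `mem_divisorLefschetzGroup_prod_iff`).

Hypotheses: `0 < dim A`; `h ∈ B¹(A) ⊗ ℂ = hodgeClassSpan A.dim A.X 1` (so that the Hodge group preserves
`Q_h` and Deligne's commutant theorem places adjoints in `End⁰(A) ⊗ ℂ`); `Q_h` non-degenerate on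
`H¹(A(ℂ); ℂ)`; `h^{dim A} ≠ 0` — all satisfied by the class of a polarization.

NOT here: `X = Y^m` for odd `m ≥ 3` (only squares — so `Y^{2j} = (Y^j)²` — are treated; the print's statement
for every `m ≥ 2` is not derived); the identification `S(A × A) = S(A)` embedded diagonally (the lane's
`Milne1999/LefschetzCentraliserPowers` treats `C(A^r) = C(A)` on `powSucc`); Table 1 by Albert type; `Δ` and
`B` for `m = 1`; `G_div` as an algebraic group over `ℚ`.

## References

* [MoonenZarhin1998WeilClasses] B. J. J. Moonen, Yu. G. Zarhin, J. reine angew. Math. 496 (1998) =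
  arXiv:alg-geom/9612017, §1: `S_λ`, `B`, `G_div(X)`, Table 1, «if `m ≥ 2` … `Δ = D`» (chunk p0002 L53–L80),
  «`B = Mat_m(D)`» (chunk p0003).
* [Milne1999LefschetzClasses] J. S. Milne, *Lefschetz classes on abelian varieties*, Duke Math. J. 96 (1999),
  §1 pp. 642–644 (`β ↦ β†`, `C(A)`, products `V(A₁ × A₂) = V(A₁) ⊕ V(A₂)` and the divisor
  `D = D₁ × A₂ + A₁ × D₂`, `S(A)`).
* [LangeBirkenhake1992] H. Lange, Ch. Birkenhake, *Complex Abelian Varieties*, §5.1 (Rosati involution =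
  adjoint for the Riemann form), §5.3 (products of polarized abelian varieties), Lemma 1.1.17, Ex. 1.1.6 (8).
* [MumfordAV1970] D. Mumford, *Abelian Varieties*, §20–§21 (Rosati involution of `Y^m`: `α ↦ ᵗα*`).
* [HatcherAT2002] A. Hatcher, *Algebraic Topology*, §3.2 Thm. 3.16 (Künneth), Thm. 3.11.
* [Deligne1982HodgeCycles] P. Deligne, LNM 900 (1982), I Prop. 3.4 (behind `rightAdjoint_mem_bicommutant`).

## Provenance

Lane `lit-hodgefound` (Track 2, Layer A), prover seat `lit-hodgefound-p21` (generation 15), row g15-#1; the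
successor note (d) of the seat's generation 14.
-/

noncomputable section

open CategoryTheory
open Literature.AlgebraicTopology.SingularHomology
open Literature.AlgebraicGeometry.Motives
open Literature.AlgebraicGeometry.VanGeemen1994 (pullbackOne hodgeClassSpan hodgeGroupOne mem_hodgeGroupOne_iff)
open Literature.AlgebraicGeometry.Milne1999
open Literature.Geometry.Kaehler (lefschetzPow)

namespace Literature.AlgebraicGeometry.HodgeTheory

variable {A : AbelianVariety ℂ} {h : complexBetti A.X 2}

/-! ## Part 0. Künneth bookkeeping on `H¹((A × A)(ℂ); ℂ) = pr₁^* H¹(A) ⊕ pr₂^* H¹(A)` -/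

/-- `(f^*).hom c = f^* c` (the two spellings of applying a pull-back). [folklore] -/
private theorem hom_apply' {Y Z : SchemeOver ℂ} (f : Y ⟶ Z) (k : ℕ) (c : complexBetti Z k) :
    (complexBetti.map f k).hom c = complexBetti.map f k c := rfl

/-- `ι₁^* pr₁^* a = a`. [cite: HatcherAT2002, §3.2 Thm. 3.16] -/
private theorem secFst_fst (a : complexBetti A.X 1) :
    complexBetti.map (AbelianVariety.prodLift (𝟙 A) (0 : A ⟶ A)).hom.hom.hom 1
      (complexBetti.map (AbelianVariety.fst A A).hom.hom.hom 1 a) = a :=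
  map_inlSection_map_fst_one a

/-- `ι₁^* pr₂^* a = 0`. [cite: HatcherAT2002, §3.2 Thm. 3.16] -/
private theorem secFst_snd (a : complexBetti A.X 1) :
    complexBetti.map (AbelianVariety.prodLift (𝟙 A) (0 : A ⟶ A)).hom.hom.hom 1
      (complexBetti.map (AbelianVariety.snd A A).hom.hom.hom 1 a) = 0 :=
  map_inlSection_map_snd_one a

/-- `ι₂^* pr₁^* a = 0`. [cite: HatcherAT2002, §3.2 Thm. 3.16] -/
private theorem secSnd_fst (a : complexBetti A.X 1) :
    complexBetti.map (AbelianVariety.prodLift (0 : A ⟶ A) (𝟙 A)).hom.hom.hom 1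
      (complexBetti.map (AbelianVariety.fst A A).hom.hom.hom 1 a) = 0 :=
  map_inrSection_map_fst_one a

/-- `ι₂^* pr₂^* a = a`. [cite: HatcherAT2002, §3.2 Thm. 3.16] -/
private theorem secSnd_snd (a : complexBetti A.X 1) :
    complexBetti.map (AbelianVariety.prodLift (0 : A ⟶ A) (𝟙 A)).hom.hom.hom 1
      (complexBetti.map (AbelianVariety.snd A A).hom.hom.hom 1 a) = a :=
  map_inrSection_map_snd_one a

/-! ## Part 1. Every pull-back on `A × A` is the sum of its four blocks («`End⁰(X) = Mat_m(D)`») -/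

/-- **The four blocks of `ψ^*`, `ψ ∈ End(A × A)`**: on `H¹((A × A)(ℂ); ℂ) = pr₁^* H¹(A) ⊕ pr₂^* H¹(A)`,
`ψ^* = Σ_{k,j} pr_k^* ∘ (ι_k ≫ ψ ≫ pr_j)^* ∘ ι_j^*` with `ι₁ = (𝟙, 0)`, `ι₂ = (0, 𝟙)` — the matrix
`(ψ_{kj}) ∈ Mat₂(End(A))` of `ψ` read on `H¹` («`V(A₁ × A₂) = V(A₁) ⊕ V(A₂)`»; «`End⁰(X) = Mat_m(D)`»).
[cite: Milne1999LefschetzClasses, §1 p. 643] [cite: MoonenZarhin1998WeilClasses, §1 (chunk p0002)]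
[cite: HatcherAT2002, §3.2 Thm. 3.16] -/
theorem pullbackOne_prod_apply_eq_sum (ψ : A.prod A ⟶ A.prod A) (x : complexBetti (A.prod A).X 1) :
    pullbackOne (A.prod A) ψ x =
      complexBetti.map (AbelianVariety.fst A A).hom.hom.hom 1
          (pullbackOne A (AbelianVariety.prodLift (𝟙 A) (0 : A ⟶ A) ≫ ψ ≫ AbelianVariety.fst A A)
            (complexBetti.map (AbelianVariety.prodLift (𝟙 A) (0 : A ⟶ A)).hom.hom.hom 1 x)) +
        complexBetti.map (AbelianVariety.snd A A).hom.hom.hom 1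
          (pullbackOne A (AbelianVariety.prodLift (0 : A ⟶ A) (𝟙 A) ≫ ψ ≫ AbelianVariety.fst A A)
            (complexBetti.map (AbelianVariety.prodLift (𝟙 A) (0 : A ⟶ A)).hom.hom.hom 1 x)) +
        complexBetti.map (AbelianVariety.fst A A).hom.hom.hom 1
          (pullbackOne A (AbelianVariety.prodLift (𝟙 A) (0 : A ⟶ A) ≫ ψ ≫ AbelianVariety.snd A A)
            (complexBetti.map (AbelianVariety.prodLift (0 : A ⟶ A) (𝟙 A)).hom.hom.hom 1 x)) +
        complexBetti.map (AbelianVariety.snd A A).hom.hom.hom 1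
          (pullbackOne A (AbelianVariety.prodLift (0 : A ⟶ A) (𝟙 A) ≫ ψ ≫ AbelianVariety.snd A A)
            (complexBetti.map (AbelianVariety.prodLift (0 : A ⟶ A) (𝟙 A)).hom.hom.hom 1 x)) := by
  -- write the blocks as `pr_k^* ι_k^* (ψ^* (pr_j^* ι_j^* x))` and reassemble with Künneth (twice)
  simp only [hom_apply']
  repeat rw [complexBetti_map_comp_apply]
  rw [← eq_map_fst_add_map_snd_one, add_assoc, ← eq_map_fst_add_map_snd_one, ← map_add,
    ← eq_map_fst_add_map_snd_one x]

/-- **Block calculus**: the section identities `ι₁^* pr₁^* = 1`, `ι₂^* pr₂^* = 1`, `ι₁^* pr₂^* = 0 = ι₂^* pr₁^*`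
make the operators `P ∘ S ∘ ι_j^*`, `pr_{j'}^* ∘ T ∘ I` multiply like matrix units. [cite: HatcherAT2002, §3.2 Thm. 3.16] -/
private theorem block_mul_inl_fst {P : complexBetti A.X 1 →ₗ[ℂ] complexBetti (A.prod A).X 1}
    {I : complexBetti (A.prod A).X 1 →ₗ[ℂ] complexBetti A.X 1} (S T : Module.End ℂ (complexBetti A.X 1)) :
    (P ∘ₗ S ∘ₗ (complexBetti.map (AbelianVariety.prodLift (𝟙 A) (0 : A ⟶ A)).hom.hom.hom 1).hom)
        * ((complexBetti.map (AbelianVariety.fst A A).hom.hom.hom 1).hom ∘ₗ T ∘ₗ I) = P ∘ₗ (S * T) ∘ₗ I := by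
  refine LinearMap.ext fun x ↦ ?_
  simp only [Module.End.mul_apply, LinearMap.comp_apply, hom_apply']
  rw [secFst_fst]

/-- `(P ∘ S ∘ ι₁^*) (pr₂^* ∘ T ∘ I) = 0`. [cite: HatcherAT2002, §3.2 Thm. 3.16] -/
private theorem block_mul_inl_snd {P : complexBetti A.X 1 →ₗ[ℂ] complexBetti (A.prod A).X 1}
    {I : complexBetti (A.prod A).X 1 →ₗ[ℂ] complexBetti A.X 1} (S T : Module.End ℂ (complexBetti A.X 1)) :
    (P ∘ₗ S ∘ₗ (complexBetti.map (AbelianVariety.prodLift (𝟙 A) (0 : A ⟶ A)).hom.hom.hom 1).hom)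
        * ((complexBetti.map (AbelianVariety.snd A A).hom.hom.hom 1).hom ∘ₗ T ∘ₗ I) = 0 := by
  refine LinearMap.ext fun x ↦ ?_
  simp only [Module.End.mul_apply, LinearMap.comp_apply, hom_apply', LinearMap.zero_apply]
  rw [secFst_snd, map_zero, map_zero]

/-- `(P ∘ S ∘ ι₂^*) (pr₁^* ∘ T ∘ I) = 0`. [cite: HatcherAT2002, §3.2 Thm. 3.16] -/
private theorem block_mul_inr_fst {P : complexBetti A.X 1 →ₗ[ℂ] complexBetti (A.prod A).X 1}
    {I : complexBetti (A.prod A).X 1 →ₗ[ℂ] complexBetti A.X 1} (S T : Module.End ℂ (complexBetti A.X 1)) :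
    (P ∘ₗ S ∘ₗ (complexBetti.map (AbelianVariety.prodLift (0 : A ⟶ A) (𝟙 A)).hom.hom.hom 1).hom)
        * ((complexBetti.map (AbelianVariety.fst A A).hom.hom.hom 1).hom ∘ₗ T ∘ₗ I) = 0 := by
  refine LinearMap.ext fun x ↦ ?_
  simp only [Module.End.mul_apply, LinearMap.comp_apply, hom_apply', LinearMap.zero_apply]
  rw [secSnd_fst, map_zero, map_zero]

/-- `(P ∘ S ∘ ι₂^*) (pr₂^* ∘ T ∘ I) = P ∘ S T ∘ I`. [cite: HatcherAT2002, §3.2 Thm. 3.16] -/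
private theorem block_mul_inr_snd {P : complexBetti A.X 1 →ₗ[ℂ] complexBetti (A.prod A).X 1}
    {I : complexBetti (A.prod A).X 1 →ₗ[ℂ] complexBetti A.X 1} (S T : Module.End ℂ (complexBetti A.X 1)) :
    (P ∘ₗ S ∘ₗ (complexBetti.map (AbelianVariety.prodLift (0 : A ⟶ A) (𝟙 A)).hom.hom.hom 1).hom)
        * ((complexBetti.map (AbelianVariety.snd A A).hom.hom.hom 1).hom ∘ₗ T ∘ₗ I) = P ∘ₗ (S * T) ∘ₗ I := by
  refine LinearMap.ext fun x ↦ ?_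
  simp only [Module.End.mul_apply, LinearMap.comp_apply, hom_apply']
  rw [secSnd_snd]

/-- `(pr₁ ≫ ι₁)^* = pr₁^* ∘ 1 ∘ ι₁^*` in block form. [cite: HatcherAT2002, §3.2 Thm. 3.16] -/
private theorem pullbackOne_fst_inl_eq_block :
    pullbackOne (A.prod A) (AbelianVariety.fst A A ≫ AbelianVariety.prodLift (𝟙 A) (0 : A ⟶ A)) =
      (complexBetti.map (AbelianVariety.fst A A).hom.hom.hom 1).hom
          ∘ₗ (1 : Module.End ℂ (complexBetti A.X 1))
          ∘ₗ (complexBetti.map (AbelianVariety.prodLift (𝟙 A) (0 : A ⟶ A)).hom.hom.hom 1).hom := by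
  refine LinearMap.ext fun x ↦ ?_
  simp only [LinearMap.comp_apply, Module.End.one_apply, hom_apply']
  rw [complexBetti_map_comp_apply]

/-- `(pr₂ ≫ ι₂)^* = pr₂^* ∘ 1 ∘ ι₂^*` in block form. [cite: HatcherAT2002, §3.2 Thm. 3.16] -/
private theorem pullbackOne_snd_inr_eq_block :
    pullbackOne (A.prod A) (AbelianVariety.snd A A ≫ AbelianVariety.prodLift (0 : A ⟶ A) (𝟙 A)) =
      (complexBetti.map (AbelianVariety.snd A A).hom.hom.hom 1).hom
          ∘ₗ (1 : Module.End ℂ (complexBetti A.X 1))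
          ∘ₗ (complexBetti.map (AbelianVariety.prodLift (0 : A ⟶ A) (𝟙 A)).hom.hom.hom 1).hom := by
  refine LinearMap.ext fun x ↦ ?_
  simp only [LinearMap.comp_apply, Module.End.one_apply, hom_apply']
  rw [complexBetti_map_comp_apply]

/-- The swap `(pr₁ ≫ ι₂)^* + (pr₂ ≫ ι₁)^* = pr₁^* ∘ 1 ∘ ι₂^* + pr₂^* ∘ 1 ∘ ι₁^*` in block form.
[cite: HatcherAT2002, §3.2 Thm. 3.16] -/
private theorem swap_eq_block :
    pullbackOne (A.prod A) (AbelianVariety.fst A A ≫ AbelianVariety.prodLift (0 : A ⟶ A) (𝟙 A)) +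
        pullbackOne (A.prod A) (AbelianVariety.snd A A ≫ AbelianVariety.prodLift (𝟙 A) (0 : A ⟶ A)) =
      (complexBetti.map (AbelianVariety.fst A A).hom.hom.hom 1).hom
          ∘ₗ (1 : Module.End ℂ (complexBetti A.X 1))
          ∘ₗ (complexBetti.map (AbelianVariety.prodLift (0 : A ⟶ A) (𝟙 A)).hom.hom.hom 1).hom +
        (complexBetti.map (AbelianVariety.snd A A).hom.hom.hom 1).hom
            ∘ₗ (1 : Module.End ℂ (complexBetti A.X 1))
            ∘ₗ (complexBetti.map (AbelianVariety.prodLift (𝟙 A) (0 : A ⟶ A)).hom.hom.hom 1).hom := by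
  refine LinearMap.ext fun x ↦ ?_
  simp only [LinearMap.add_apply, LinearMap.comp_apply, Module.End.one_apply, hom_apply']
  rw [complexBetti_map_comp_apply, complexBetti_map_comp_apply]

/-! ## Part 2. The pairing of `H = pr₁^* h + pr₂^* h` through the reduced pairing
`q(x, y) = Q_h(ι₁^*x, ι₁^*y) + Q_h(ι₂^*x, ι₂^*y)` -/

section Pairing

/-- **The top line**: `H^{2g}(A(ℂ); ℂ)` (`g = dim A > 0`, degree written `2 + 2(g - 1)`) is spanned by
`h^g` as soon as `h^g ≠ 0` (`dim H^{2g} = C(2g, 2g) = 1`). [cite: LangeBirkenhake1992, Exercise 1.1.6 (8) and Lemma 1.1.17] -/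
theorem exists_eq_smul_lefschetzPow_top (hA0 : 0 < A.dim) (htop : lefschetzPow h (A.dim - 1) 2 h ≠ 0)
    (z : complexBetti A.X (2 + 2 * (A.dim - 1))) : ∃ c : ℂ, z = c • lefschetzPow h (A.dim - 1) 2 h := by
  have h1 : Module.finrank ℂ (complexBetti A.X (2 + 2 * (A.dim - 1))) = 1 := by
    rw [abelianVarietyCohomologyExteriorH1_holds.finrank_eq, show 2 + 2 * (A.dim - 1) = 2 * A.dim by omega,
      Nat.choose_self]
  obtain ⟨c, hc⟩ := (finrank_eq_one_iff_of_nonzero' _ htop).1 h1 z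
  exact ⟨c, hc.symm⟩

/-- **Swapping a top class across the two factors**: `pr₁^* z ⌣ pr₂^* h^g = pr₁^* h^g ⌣ pr₂^* z` in
`H^{4g}((A × A)(ℂ); ℂ)` for every top class `z ∈ H^{2g}(A(ℂ); ℂ) = ℂ · h^g`.
[cite: LangeBirkenhake1992, §5.3 and Exercise 1.1.6 (8)] [cite: HatcherAT2002, §3.2 Thm. 3.16] -/
theorem cupProduct_map_fst_map_snd_top_comm (hA0 : 0 < A.dim) (htop : lefschetzPow h (A.dim - 1) 2 h ≠ 0)
    (z : complexBetti A.X (2 + 2 * (A.dim - 1))) :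
    cupProduct (prod_topDeg_eq hA0 hA0)
        (complexBetti.map (AbelianVariety.fst A A).hom.hom.hom (2 + 2 * (A.dim - 1)) z)
        (complexBetti.map (AbelianVariety.snd A A).hom.hom.hom (2 + 2 * (A.dim - 1))
          (lefschetzPow h (A.dim - 1) 2 h)) =
      cupProduct (prod_topDeg_eq hA0 hA0)
        (complexBetti.map (AbelianVariety.fst A A).hom.hom.hom (2 + 2 * (A.dim - 1))
          (lefschetzPow h (A.dim - 1) 2 h))
        (complexBetti.map (AbelianVariety.snd A A).hom.hom.hom (2 + 2 * (A.dim - 1)) z) := by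
  obtain ⟨c, rfl⟩ := exists_eq_smul_lefschetzPow_top hA0 htop z
  rw [map_smul, LinearMap.map_smul₂, map_smul, map_smul]

/-- `C(2g - 1, g - 1) = C(2g - 1, g)`: the two binomial weights of the block Gram formula of `A × A` agree.
[cite: LangeBirkenhake1992, §5.3] -/
private theorem choose_prodSelf_eq (hA0 : 0 < A.dim) :
    ((A.prod A).dim - 1).choose (A.dim - 1 + 1) = ((A.prod A).dim - 1).choose (A.dim - 1) := by
  rw [AbelianVariety.dim_prod]
  exact Nat.choose_symm_of_eq_add (by omega)

/-- **The polarization pairing of `H = pr₁^* h + pr₂^* h` on `H¹((A × A)(ℂ); ℂ)` through the reduced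
pairing**: `Q_H(x, y) = C(2g−1, g−1) · pr₁^*(h^g) ⌣ pr₂^*(Q_h(ι₁^*x, ι₁^*y) + Q_h(ι₂^*x, ι₂^*y))` — the block
Gram formula «`Q_D(pr_A^* a + pr_B^* b, pr_A^* a' + pr_B^* b') = C₁ · pr_A^* Q(a, a') ⌣ pr_B^* h^g +
C₂ · pr_A^* h^g ⌣ pr_B^* Q(b, b')`» of the lane's `polarizationPairingOne_prod_add_add` for `B = A`, with
`C₁ = C₂` and the top-class swap. («the involution `D` defines on `C(A)` is the restriction of the product
of the involutions», Milne §1 p. 643; Lange–Birkenhake §5.3.) [cite: Milne1999LefschetzClasses, §1 p. 643]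
[cite: LangeBirkenhake1992, §5.3] -/
theorem polarizationPairingOne_prodSelf_eq (hA0 : 0 < A.dim) (htop : lefschetzPow h (A.dim - 1) 2 h ≠ 0)
    (x y : complexBetti (A.prod A).X 1) :
    polarizationPairingOne (A.prod A).X (prodPolarizationClass A A h h) ((A.prod A).dim - 1) x y =
      ((((A.prod A).dim - 1).choose (A.dim - 1) : ℕ) : ℂ) • cupProduct (prod_topDeg_eq hA0 hA0)
        (complexBetti.map (AbelianVariety.fst A A).hom.hom.hom (2 + 2 * (A.dim - 1))
          (lefschetzPow h (A.dim - 1) 2 h))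
        (complexBetti.map (AbelianVariety.snd A A).hom.hom.hom (2 + 2 * (A.dim - 1))
          (polarizationPairingOne A.X h (A.dim - 1)
              (complexBetti.map (AbelianVariety.prodLift (𝟙 A) (0 : A ⟶ A)).hom.hom.hom 1 x)
              (complexBetti.map (AbelianVariety.prodLift (𝟙 A) (0 : A ⟶ A)).hom.hom.hom 1 y) +
            polarizationPairingOne A.X h (A.dim - 1)
              (complexBetti.map (AbelianVariety.prodLift (0 : A ⟶ A) (𝟙 A)).hom.hom.hom 1 x)
              (complexBetti.map (AbelianVariety.prodLift (0 : A ⟶ A) (𝟙 A)).hom.hom.hom 1 y))) := by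
  conv_lhs => rw [eq_map_fst_add_map_snd_one x, eq_map_fst_add_map_snd_one y]
  rw [polarizationPairingOne_prod_add_add h h hA0 hA0, cupProduct_map_fst_map_snd_top_comm hA0 htop,
    choose_prodSelf_eq hA0, map_add, map_add, smul_add]

/-- **A `q`-self-adjoint endomorphism of `H¹((A × A)(ℂ); ℂ)` is `Q_H`-self-adjoint**, `q` the reduced
pairing `q(x, y) = Q_h(ι₁^*x, ι₁^*y) + Q_h(ι₂^*x, ι₂^*y)` («the involution `D` defines on `C(A)` is the
restriction of the product of the involutions on the `C(Aᵢ)` defined by the `Dᵢ`»).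
[cite: Milne1999LefschetzClasses, §1 p. 643] [cite: LangeBirkenhake1992, §5.3] -/
theorem polarizationPairingOne_prod_comm_of_reduced (hA0 : 0 < A.dim)
    (htop : lefschetzPow h (A.dim - 1) 2 h ≠ 0) {T : Module.End ℂ (complexBetti (A.prod A).X 1)}
    (hT : ∀ x y : complexBetti (A.prod A).X 1,
      polarizationPairingOne A.X h (A.dim - 1)
            (complexBetti.map (AbelianVariety.prodLift (𝟙 A) (0 : A ⟶ A)).hom.hom.hom 1 (T x))
            (complexBetti.map (AbelianVariety.prodLift (𝟙 A) (0 : A ⟶ A)).hom.hom.hom 1 y) +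
          polarizationPairingOne A.X h (A.dim - 1)
            (complexBetti.map (AbelianVariety.prodLift (0 : A ⟶ A) (𝟙 A)).hom.hom.hom 1 (T x))
            (complexBetti.map (AbelianVariety.prodLift (0 : A ⟶ A) (𝟙 A)).hom.hom.hom 1 y) =
        polarizationPairingOne A.X h (A.dim - 1)
            (complexBetti.map (AbelianVariety.prodLift (𝟙 A) (0 : A ⟶ A)).hom.hom.hom 1 x)
            (complexBetti.map (AbelianVariety.prodLift (𝟙 A) (0 : A ⟶ A)).hom.hom.hom 1 (T y)) +
          polarizationPairingOne A.X h (A.dim - 1)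
            (complexBetti.map (AbelianVariety.prodLift (0 : A ⟶ A) (𝟙 A)).hom.hom.hom 1 x)
            (complexBetti.map (AbelianVariety.prodLift (0 : A ⟶ A) (𝟙 A)).hom.hom.hom 1 (T y)))
    (x y : complexBetti (A.prod A).X 1) :
    polarizationPairingOne (A.prod A).X (prodPolarizationClass A A h h) ((A.prod A).dim - 1) (T x) y =
      polarizationPairingOne (A.prod A).X (prodPolarizationClass A A h h) ((A.prod A).dim - 1) x (T y) := by
  rw [polarizationPairingOne_prodSelf_eq hA0 htop, polarizationPairingOne_prodSelf_eq hA0 htop, hT]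

end Pairing

/-! ## Part 3. The Rosati adjoint inside `End⁰(A) ⊗ ℂ` -/

/-- `Q_h(y, x) = -Q_h(x, y)` in degree one (graded commutativity). [cite: HatcherAT2002, §3.2 Thm. 3.11] -/
private theorem pairingOne_swap (x y : complexBetti A.X 1) :
    polarizationPairingOne A.X h (A.dim - 1) y x = -polarizationPairingOne A.X h (A.dim - 1) x y := by
  rw [Motives.polarizationPairingOne_apply, Motives.polarizationPairingOne_apply,
    cupProduct_gradedComm_holds (R := ℂ) (X := ComplexPoints A.X) rfl rfl y x, map_smul, pow_one,
    neg_one_smul]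

/-- **The Rosati involution preserves `End⁰(A) ⊗ ℂ`** («`β ↦ β†` is an involution of `End_k(V(A))` whose
restriction to `End⁰(A)` is the Rosati involution defined by `D`»; Lange–Birkenhake §5.1): for
`h ∈ B¹(A) ⊗ ℂ` with `Q_h` non-degenerate on `H¹(A(ℂ); ℂ)`, every `T` in the `ℂ`-span of the pull-backs
`φ^*`, `φ ∈ End(A)`, has a `Q_h`-adjoint `T†` in that span: `Q_h(Tx, y) = Q_h(x, T†y)`.  (The lane's
`Milne1999.rightAdjoint_mem_bicommutant` — Deligne I 3.4 + Riemann — read through a scalar form `λ ∘ Q_h`.)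
[cite: Milne1999LefschetzClasses, §1 pp. 642–643] [cite: LangeBirkenhake1992, §5.1]
[cite: Deligne1982HodgeCycles, I §3 Prop. 3.4] -/
theorem exists_adjoint_mem_span_pullbackOne (hh : h ∈ hodgeClassSpan A.dim A.X 1)
    (hnd : ∀ x : complexBetti A.X 1, (∀ y, polarizationPairingOne A.X h (A.dim - 1) x y = 0) → x = 0)
    {T : Module.End ℂ (complexBetti A.X 1)}
    (hT : T ∈ Submodule.span ℂ (Set.range fun φ : A ⟶ A ↦ pullbackOne A φ)) :
    ∃ T' ∈ Submodule.span ℂ (Set.range fun φ : A ⟶ A ↦ pullbackOne A φ),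
      ∀ x y : complexBetti A.X 1, polarizationPairingOne A.X h (A.dim - 1) (T x) y =
        polarizationPairingOne A.X h (A.dim - 1) x (T' y) := by
  obtain ⟨B, hBalt, hBnd, lam, hlam, hB⟩ := exists_bilinForm_isAlt_nondegenerate (A := A) hnd
  have hBHg : ∀ g ∈ hodgeGroup A.dim A.X, ∀ v w : complexBetti A.X 1, B (g 1 v) (g 1 w) = B v w :=
    fun g hg v w ↦ by
      rw [hB, hB, (hodgeGroupOne_le_unitaryCentralizerGroup hh (mem_hodgeGroupOne_iff.2 ⟨g, hg, rfl⟩)).2 v w]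
  obtain ⟨T', hT'⟩ := exists_rightAdjoint hBnd T
  refine ⟨T', mem_bicommutant_iff_mem_span.1
    (rightAdjoint_mem_bicommutant hBnd hBHg (mem_bicommutant_iff_mem_span.2 hT) hT'), fun x y ↦ hlam ?_⟩
  rw [← hB, ← hB]
  exact bilin_apply_left_of_rightAdjoint hBalt hT' x y

/-! ## Part 4. The `†`-hermitian elements of `S_λ(A × A) ⊗ ℂ` -/

section Hermitian

variable (A h)

/-- **The projector `(pr₁ ≫ ι₁)^* = pr₁^* ∘ ι₁^*` onto `pr₁^* H¹(A)` is in `S_λ(A × A) ⊗ ℂ`** (the diagonal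
idempotent `E₁₁ ∈ Mat₂(D)` is `†`-symmetric for the product polarization: «`α† = (α*_{ji})`»).
[cite: MoonenZarhin1998WeilClasses, §1 (chunk p0002: S_λ, «α† = (α*_{ji})»)] [cite: Milne1999LefschetzClasses, §1 p. 643] -/
theorem pullbackOne_fst_inl_mem_symmetricPullbackSpan_prod (hA0 : 0 < A.dim)
    (htop : lefschetzPow h (A.dim - 1) 2 h ≠ 0) :
    pullbackOne (A.prod A) (AbelianVariety.fst A A ≫ AbelianVariety.prodLift (𝟙 A) (0 : A ⟶ A)) ∈
      symmetricPullbackSpan (A.prod A) (prodPolarizationClass A A h h) := by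
  refine ⟨Submodule.subset_span ⟨_, rfl⟩, polarizationPairingOne_prod_comm_of_reduced hA0 htop fun x y ↦ ?_⟩
  simp only [hom_apply']
  rw [complexBetti_map_comp_apply, complexBetti_map_comp_apply, secFst_fst, secFst_fst, secSnd_fst, secSnd_fst]
  simp only [map_zero, LinearMap.zero_apply, add_zero]

/-- **The projector `(pr₂ ≫ ι₂)^* = pr₂^* ∘ ι₂^*` onto `pr₂^* H¹(A)` is in `S_λ(A × A) ⊗ ℂ`** (the diagonal
idempotent `E₂₂`). [cite: MoonenZarhin1998WeilClasses, §1 (chunk p0002: S_λ, «α† = (α*_{ji})»)]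
[cite: Milne1999LefschetzClasses, §1 p. 643] -/
theorem pullbackOne_snd_inr_mem_symmetricPullbackSpan_prod (hA0 : 0 < A.dim)
    (htop : lefschetzPow h (A.dim - 1) 2 h ≠ 0) :
    pullbackOne (A.prod A) (AbelianVariety.snd A A ≫ AbelianVariety.prodLift (0 : A ⟶ A) (𝟙 A)) ∈
      symmetricPullbackSpan (A.prod A) (prodPolarizationClass A A h h) := by
  refine ⟨Submodule.subset_span ⟨_, rfl⟩, polarizationPairingOne_prod_comm_of_reduced hA0 htop fun x y ↦ ?_⟩
  simp only [hom_apply']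
  rw [complexBetti_map_comp_apply, complexBetti_map_comp_apply, secFst_snd, secFst_snd, secSnd_snd, secSnd_snd]
  simp only [map_zero, LinearMap.zero_apply, zero_add]

/-- **The transposition `(pr₁ ≫ ι₂)^* + (pr₂ ≫ ι₁)^* = pr₁^* ∘ ι₂^* + pr₂^* ∘ ι₁^*` (the swap of the two
factors read on `H¹`) is in `S_λ(A × A) ⊗ ℂ`** (`E₁₂ + E₂₁` is `†`-hermitian).
[cite: MoonenZarhin1998WeilClasses, §1 (chunk p0002: S_λ, «α† = (α*_{ji})»)] [cite: Milne1999LefschetzClasses, §1 p. 643] -/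
theorem swap_mem_symmetricPullbackSpan_prod (hA0 : 0 < A.dim) (htop : lefschetzPow h (A.dim - 1) 2 h ≠ 0) :
    pullbackOne (A.prod A) (AbelianVariety.fst A A ≫ AbelianVariety.prodLift (0 : A ⟶ A) (𝟙 A)) +
        pullbackOne (A.prod A) (AbelianVariety.snd A A ≫ AbelianVariety.prodLift (𝟙 A) (0 : A ⟶ A)) ∈
      symmetricPullbackSpan (A.prod A) (prodPolarizationClass A A h h) := by
  refine ⟨Submodule.add_mem _ (Submodule.subset_span ⟨_, rfl⟩) (Submodule.subset_span ⟨_, rfl⟩),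
    polarizationPairingOne_prod_comm_of_reduced hA0 htop fun x y ↦ ?_⟩
  simp only [LinearMap.add_apply, hom_apply', map_add]
  rw [complexBetti_map_comp_apply, complexBetti_map_comp_apply, complexBetti_map_comp_apply,
    complexBetti_map_comp_apply, secFst_fst, secFst_fst, secFst_snd, secFst_snd, secSnd_fst, secSnd_fst, secSnd_snd, secSnd_snd]
  simp only [map_zero, LinearMap.zero_apply, add_zero, zero_add]
  exact add_comm _ _

variable {A h}

/-- `pr₁^* ∘ T ∘ ι₂^*` lies in the span of the pull-backs of `A × A` whenever `T` lies in the span of the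
pull-backs of `A` (`pr₁^* ∘ φ^* ∘ ι₂^* = (pr₁ ≫ φ ≫ ι₂)^*`). [cite: Milne1999LefschetzClasses, §1 p. 643] -/
theorem fst_comp_comp_inr_mem_span {T : Module.End ℂ (complexBetti A.X 1)}
    (hT : T ∈ Submodule.span ℂ (Set.range fun φ : A ⟶ A ↦ pullbackOne A φ)) :
    (complexBetti.map (AbelianVariety.fst A A).hom.hom.hom 1).hom ∘ₗ T
        ∘ₗ (complexBetti.map (AbelianVariety.prodLift (0 : A ⟶ A) (𝟙 A)).hom.hom.hom 1).hom
        ∈ Submodule.span ℂ (Set.range fun ψ : A.prod A ⟶ A.prod A ↦ pullbackOne (A.prod A) ψ) := by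
  induction hT using Submodule.span_induction with
  | mem S hS =>
    obtain ⟨φ, rfl⟩ := hS
    refine Submodule.subset_span ⟨AbelianVariety.fst A A ≫ φ ≫ AbelianVariety.prodLift (0 : A ⟶ A) (𝟙 A), ?_⟩
    refine LinearMap.ext fun x ↦ ?_
    simp only [LinearMap.comp_apply, hom_apply']
    rw [complexBetti_map_comp_apply, complexBetti_map_comp_apply]
  | zero => rw [LinearMap.zero_comp, LinearMap.comp_zero]; exact Submodule.zero_mem _
  | add S S' _ _ hS hS' => rw [LinearMap.add_comp, LinearMap.comp_add]; exact Submodule.add_mem _ hS hS'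
  | smul c S _ hS => rw [LinearMap.smul_comp, LinearMap.comp_smul]; exact Submodule.smul_mem _ c hS

/-- `pr₂^* ∘ T ∘ ι₁^*` lies in the span of the pull-backs of `A × A` whenever `T` lies in the span of the
pull-backs of `A` (`pr₂^* ∘ φ^* ∘ ι₁^* = (pr₂ ≫ φ ≫ ι₁)^*`). [cite: Milne1999LefschetzClasses, §1 p. 643] -/
theorem snd_comp_comp_inl_mem_span {T : Module.End ℂ (complexBetti A.X 1)}
    (hT : T ∈ Submodule.span ℂ (Set.range fun φ : A ⟶ A ↦ pullbackOne A φ)) :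
    (complexBetti.map (AbelianVariety.snd A A).hom.hom.hom 1).hom ∘ₗ T
        ∘ₗ (complexBetti.map (AbelianVariety.prodLift (𝟙 A) (0 : A ⟶ A)).hom.hom.hom 1).hom
        ∈ Submodule.span ℂ (Set.range fun ψ : A.prod A ⟶ A.prod A ↦ pullbackOne (A.prod A) ψ) := by
  induction hT using Submodule.span_induction with
  | mem S hS =>
    obtain ⟨φ, rfl⟩ := hS
    refine Submodule.subset_span ⟨AbelianVariety.snd A A ≫ φ ≫ AbelianVariety.prodLift (𝟙 A) (0 : A ⟶ A), ?_⟩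
    refine LinearMap.ext fun x ↦ ?_
    simp only [LinearMap.comp_apply, hom_apply']
    rw [complexBetti_map_comp_apply, complexBetti_map_comp_apply]
  | zero => rw [LinearMap.zero_comp, LinearMap.comp_zero]; exact Submodule.zero_mem _
  | add S S' _ _ hS hS' => rw [LinearMap.add_comp, LinearMap.comp_add]; exact Submodule.add_mem _ hS hS'
  | smul c S _ hS => rw [LinearMap.smul_comp, LinearMap.comp_smul]; exact Submodule.smul_mem _ c hS

/-- **The `†`-hermitian off-diagonal elements**: for `T ∈ End⁰(A) ⊗ ℂ` with `Q_h`-adjoint `T† ∈ End⁰(A) ⊗ ℂ`,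
`pr₁^* ∘ T ∘ ι₂^* + pr₂^* ∘ T† ∘ ι₁^*` — the carrier form of `E₁₂(d) + E₂₁(d*)`, `†`-symmetric by
«`α† = (α*_{ji})`» — lies in `S_λ(A × A) ⊗ ℂ = symmetricPullbackSpan (A.prod A) (pr₁^* h + pr₂^* h)`.
[cite: MoonenZarhin1998WeilClasses, §1 (chunk p0002: S_λ, «α† = (α*_{ji})», Table 1)]
[cite: MumfordAV1970, §21] [cite: Milne1999LefschetzClasses, §1 p. 643] -/
theorem hermitian_mem_symmetricPullbackSpan_prod (hA0 : 0 < A.dim) (htop : lefschetzPow h (A.dim - 1) 2 h ≠ 0)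
    {T T' : Module.End ℂ (complexBetti A.X 1)}
    (hT : T ∈ Submodule.span ℂ (Set.range fun φ : A ⟶ A ↦ pullbackOne A φ))
    (hT'm : T' ∈ Submodule.span ℂ (Set.range fun φ : A ⟶ A ↦ pullbackOne A φ))
    (hT' : ∀ x y : complexBetti A.X 1, polarizationPairingOne A.X h (A.dim - 1) (T x) y =
      polarizationPairingOne A.X h (A.dim - 1) x (T' y)) :
    (complexBetti.map (AbelianVariety.fst A A).hom.hom.hom 1).hom ∘ₗ T
        ∘ₗ (complexBetti.map (AbelianVariety.prodLift (0 : A ⟶ A) (𝟙 A)).hom.hom.hom 1).hom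
        + (complexBetti.map (AbelianVariety.snd A A).hom.hom.hom 1).hom ∘ₗ T'
        ∘ₗ (complexBetti.map (AbelianVariety.prodLift (𝟙 A) (0 : A ⟶ A)).hom.hom.hom 1).hom ∈
      symmetricPullbackSpan (A.prod A) (prodPolarizationClass A A h h) := by
  refine ⟨Submodule.add_mem _ (fst_comp_comp_inr_mem_span hT) (snd_comp_comp_inl_mem_span hT'm),
    polarizationPairingOne_prod_comm_of_reduced hA0 htop fun x y ↦ ?_⟩
  simp only [LinearMap.add_apply, LinearMap.comp_apply, hom_apply', map_add]
  rw [secFst_fst, secFst_fst, secFst_snd, secFst_snd, secSnd_fst, secSnd_fst, secSnd_snd, secSnd_snd]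
  simp only [map_zero, LinearMap.zero_apply, add_zero, zero_add]
  rw [hT', adjoint_adjoint_polarizationPairingOne hT']
  exact add_comm _ _

end Hermitian

/-! ## Part 5. `B(A × A) ⊗ ℂ = End⁰(A × A) ⊗ ℂ` and `G_div(A × A) = S(A × A)` -/

section Main

/-- **Every block `pr_k^* ∘ T ∘ ι_j^*`, `T ∈ End⁰(A) ⊗ ℂ`, lies in `B(A × A) ⊗ ℂ`**, the subalgebra of
`End_ℂ H¹((A × A)(ℂ); ℂ)` generated by `S_λ(A × A) ⊗ ℂ`: with `s₁ = E₁₁`, `s₂ = E₂₂`, `σ = E₁₂ + E₂₁` and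
`m_T = E₁₂(T) + E₂₁(T†)` (Part 4), `E₁₁(T) = m_T s₂ σ`, `E₁₂(T) = E₁₁(T) s₁ σ`, `E₂₁(T) = s₂ σ E₁₁(T)`,
`E₂₂(T) = s₂ σ E₁₁(T) s₁ σ` (the Table-1 mechanism «`B = Mat_m(D)`» for `m = 2`).
[cite: MoonenZarhin1998WeilClasses, §1 (chunk p0002 L77–L80 «if m ≥ 2 … Δ = D»; chunk p0003 «B = Mat_m(D)»)] -/
theorem block_mem_adjoin_symmetricPullbackSpan_prod (hA0 : 0 < A.dim) (hh : h ∈ hodgeClassSpan A.dim A.X 1)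
    (hnd : ∀ x : complexBetti A.X 1, (∀ y, polarizationPairingOne A.X h (A.dim - 1) x y = 0) → x = 0)
    (htop : lefschetzPow h (A.dim - 1) 2 h ≠ 0) {T : Module.End ℂ (complexBetti A.X 1)}
    (hT : T ∈ Submodule.span ℂ (Set.range fun φ : A ⟶ A ↦ pullbackOne A φ)) :
    (complexBetti.map (AbelianVariety.fst A A).hom.hom.hom 1).hom ∘ₗ T
        ∘ₗ (complexBetti.map (AbelianVariety.prodLift (𝟙 A) (0 : A ⟶ A)).hom.hom.hom 1).hom ∈ Algebra.adjoin ℂ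
        (symmetricPullbackSpan (A.prod A) (prodPolarizationClass A A h h) :
          Set (Module.End ℂ (complexBetti (A.prod A).X 1))) ∧
      (complexBetti.map (AbelianVariety.fst A A).hom.hom.hom 1).hom ∘ₗ T
          ∘ₗ (complexBetti.map (AbelianVariety.prodLift (0 : A ⟶ A) (𝟙 A)).hom.hom.hom 1).hom ∈ Algebra.adjoin ℂ
        (symmetricPullbackSpan (A.prod A) (prodPolarizationClass A A h h) :
          Set (Module.End ℂ (complexBetti (A.prod A).X 1))) ∧
      (complexBetti.map (AbelianVariety.snd A A).hom.hom.hom 1).hom ∘ₗ T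
          ∘ₗ (complexBetti.map (AbelianVariety.prodLift (𝟙 A) (0 : A ⟶ A)).hom.hom.hom 1).hom ∈ Algebra.adjoin ℂ
        (symmetricPullbackSpan (A.prod A) (prodPolarizationClass A A h h) :
          Set (Module.End ℂ (complexBetti (A.prod A).X 1))) ∧
      (complexBetti.map (AbelianVariety.snd A A).hom.hom.hom 1).hom ∘ₗ T
          ∘ₗ (complexBetti.map (AbelianVariety.prodLift (0 : A ⟶ A) (𝟙 A)).hom.hom.hom 1).hom ∈ Algebra.adjoin ℂ
        (symmetricPullbackSpan (A.prod A) (prodPolarizationClass A A h h) :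
          Set (Module.End ℂ (complexBetti (A.prod A).X 1))) := by
  set 𝔅 := Algebra.adjoin ℂ (symmetricPullbackSpan (A.prod A) (prodPolarizationClass A A h h) :
    Set (Module.End ℂ (complexBetti (A.prod A).X 1)))
  -- the symmetric generators
  set s₁ : Module.End ℂ (complexBetti (A.prod A).X 1) :=
    pullbackOne (A.prod A) (AbelianVariety.fst A A ≫ AbelianVariety.prodLift (𝟙 A) (0 : A ⟶ A)) with hs₁
  set s₂ : Module.End ℂ (complexBetti (A.prod A).X 1) :=
    pullbackOne (A.prod A) (AbelianVariety.snd A A ≫ AbelianVariety.prodLift (0 : A ⟶ A) (𝟙 A)) with hs₂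
  set σ : Module.End ℂ (complexBetti (A.prod A).X 1) :=
    pullbackOne (A.prod A) (AbelianVariety.fst A A ≫ AbelianVariety.prodLift (0 : A ⟶ A) (𝟙 A)) +
      pullbackOne (A.prod A) (AbelianVariety.snd A A ≫ AbelianVariety.prodLift (𝟙 A) (0 : A ⟶ A)) with hσ
  obtain ⟨T', hT'm, hT'⟩ := exists_adjoint_mem_span_pullbackOne hh hnd hT
  set m : Module.End ℂ (complexBetti (A.prod A).X 1)
      := (complexBetti.map (AbelianVariety.fst A A).hom.hom.hom 1).hom ∘ₗ T
      ∘ₗ (complexBetti.map (AbelianVariety.prodLift (0 : A ⟶ A) (𝟙 A)).hom.hom.hom 1).hom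
      + (complexBetti.map (AbelianVariety.snd A A).hom.hom.hom 1).hom ∘ₗ T'
      ∘ₗ (complexBetti.map (AbelianVariety.prodLift (𝟙 A) (0 : A ⟶ A)).hom.hom.hom 1).hom
    with hm
  have hs₁𝔅 : s₁ ∈ 𝔅 := Algebra.subset_adjoin (pullbackOne_fst_inl_mem_symmetricPullbackSpan_prod A h hA0 htop)
  have hs₂𝔅 : s₂ ∈ 𝔅 := Algebra.subset_adjoin (pullbackOne_snd_inr_mem_symmetricPullbackSpan_prod A h hA0 htop)
  have hσ𝔅 : σ ∈ 𝔅 := Algebra.subset_adjoin (swap_mem_symmetricPullbackSpan_prod A h hA0 htop)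
  have hm𝔅 : m ∈ 𝔅 := Algebra.subset_adjoin (hermitian_mem_symmetricPullbackSpan_prod hA0 htop hT hT'm hT')
  -- block forms of the generators, and the matrix-unit products
  have e11 : (complexBetti.map (AbelianVariety.fst A A).hom.hom.hom 1).hom ∘ₗ T
      ∘ₗ (complexBetti.map (AbelianVariety.prodLift (𝟙 A) (0 : A ⟶ A)).hom.hom.hom 1).hom = m * (s₂ * σ) := by
    rw [hm, hσ, hs₂, swap_eq_block, pullbackOne_snd_inr_eq_block, mul_add, block_mul_inr_fst,
      block_mul_inr_snd, zero_add, mul_one, add_mul, block_mul_inr_snd, block_mul_inl_snd, add_zero, mul_one]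
  have h11 : (complexBetti.map (AbelianVariety.fst A A).hom.hom.hom 1).hom ∘ₗ T
      ∘ₗ (complexBetti.map (AbelianVariety.prodLift (𝟙 A) (0 : A ⟶ A)).hom.hom.hom 1).hom ∈ 𝔅 := by
    rw [e11]; exact Subalgebra.mul_mem _ hm𝔅 (Subalgebra.mul_mem _ hs₂𝔅 hσ𝔅)
  -- `E₁₂(T) = E₁₁(T) · s₁ · σ`
  have e12 : (complexBetti.map (AbelianVariety.fst A A).hom.hom.hom 1).hom ∘ₗ T
      ∘ₗ (complexBetti.map (AbelianVariety.prodLift (0 : A ⟶ A) (𝟙 A)).hom.hom.hom 1).hom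
      = ((complexBetti.map (AbelianVariety.fst A A).hom.hom.hom 1).hom ∘ₗ T
      ∘ₗ (complexBetti.map (AbelianVariety.prodLift (𝟙 A) (0 : A ⟶ A)).hom.hom.hom 1).hom) * (s₁ * σ) := by
    rw [hσ, hs₁, swap_eq_block, pullbackOne_fst_inl_eq_block, mul_add, block_mul_inl_fst, block_mul_inl_snd,
      add_zero, mul_one, block_mul_inl_fst, mul_one]
  have h12 : (complexBetti.map (AbelianVariety.fst A A).hom.hom.hom 1).hom ∘ₗ T
      ∘ₗ (complexBetti.map (AbelianVariety.prodLift (0 : A ⟶ A) (𝟙 A)).hom.hom.hom 1).hom ∈ 𝔅 := by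
    rw [e12]; exact Subalgebra.mul_mem _ h11 (Subalgebra.mul_mem _ hs₁𝔅 hσ𝔅)
  -- `E₂₁(T) = s₂ · σ · E₁₁(T)`
  have e21 : (complexBetti.map (AbelianVariety.snd A A).hom.hom.hom 1).hom ∘ₗ T
      ∘ₗ (complexBetti.map (AbelianVariety.prodLift (𝟙 A) (0 : A ⟶ A)).hom.hom.hom 1).hom = (s₂ * σ)
      * ((complexBetti.map (AbelianVariety.fst A A).hom.hom.hom 1).hom ∘ₗ T
      ∘ₗ (complexBetti.map (AbelianVariety.prodLift (𝟙 A) (0 : A ⟶ A)).hom.hom.hom 1).hom) := by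
    rw [hσ, hs₂, swap_eq_block, pullbackOne_snd_inr_eq_block, mul_add, block_mul_inr_fst, block_mul_inr_snd,
      zero_add, mul_one, block_mul_inl_fst, one_mul]
  have h21 : (complexBetti.map (AbelianVariety.snd A A).hom.hom.hom 1).hom ∘ₗ T
      ∘ₗ (complexBetti.map (AbelianVariety.prodLift (𝟙 A) (0 : A ⟶ A)).hom.hom.hom 1).hom ∈ 𝔅 := by
    rw [e21]; exact Subalgebra.mul_mem _ (Subalgebra.mul_mem _ hs₂𝔅 hσ𝔅) h11
  -- `E₂₂(T) = E₂₁(T) · s₁ · σ`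
  have e22 : (complexBetti.map (AbelianVariety.snd A A).hom.hom.hom 1).hom ∘ₗ T
      ∘ₗ (complexBetti.map (AbelianVariety.prodLift (0 : A ⟶ A) (𝟙 A)).hom.hom.hom 1).hom
      = ((complexBetti.map (AbelianVariety.snd A A).hom.hom.hom 1).hom ∘ₗ T
      ∘ₗ (complexBetti.map (AbelianVariety.prodLift (𝟙 A) (0 : A ⟶ A)).hom.hom.hom 1).hom) * (s₁ * σ) := by
    rw [hσ, hs₁, swap_eq_block, pullbackOne_fst_inl_eq_block, mul_add, block_mul_inl_fst, block_mul_inl_snd,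
      add_zero, mul_one, block_mul_inl_fst, mul_one]
  have h22 : (complexBetti.map (AbelianVariety.snd A A).hom.hom.hom 1).hom ∘ₗ T
      ∘ₗ (complexBetti.map (AbelianVariety.prodLift (0 : A ⟶ A) (𝟙 A)).hom.hom.hom 1).hom ∈ 𝔅 := by
    rw [e22]; exact Subalgebra.mul_mem _ h21 (Subalgebra.mul_mem _ hs₁𝔅 hσ𝔅)
  exact ⟨h11, h12, h21, h22⟩

/-- **Moonen–Zarhin 1998, §1: «if `m ≥ 2` … then we simply have `Δ = D`» / «`B = Mat_m(D)`», for `m = 2`, on the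
carrier.** For a complex abelian variety `A` of positive dimension and `h ∈ B¹(A) ⊗ ℂ` with `Q_h`
non-degenerate on `H¹(A(ℂ); ℂ)` and `h^{dim A} ≠ 0` (e.g. a polarization class), EVERY pull-back `ψ^*`,
`ψ ∈ End(A × A)`, lies in `B(A × A) ⊗ ℂ = Algebra.adjoin ℂ (S_λ(A × A) ⊗ ℂ)`, the subalgebra of
`End_ℂ H¹((A × A)(ℂ); ℂ)` generated by the Rosati-symmetric elements for the product polarization class
`pr₁^* h + pr₂^* h`. [cite: MoonenZarhin1998WeilClasses, §1 (chunk p0002 L77–L80; chunk p0003 «B = Mat_m(D)»)]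
[cite: Milne1999LefschetzClasses, §1 p. 643] -/
theorem pullbackOne_prod_mem_adjoin_symmetricPullbackSpan (hA0 : 0 < A.dim)
    (hh : h ∈ hodgeClassSpan A.dim A.X 1)
    (hnd : ∀ x : complexBetti A.X 1, (∀ y, polarizationPairingOne A.X h (A.dim - 1) x y = 0) → x = 0)
    (htop : lefschetzPow h (A.dim - 1) 2 h ≠ 0) (ψ : A.prod A ⟶ A.prod A) :
    pullbackOne (A.prod A) ψ ∈ Algebra.adjoin ℂ
      (symmetricPullbackSpan (A.prod A) (prodPolarizationClass A A h h) :
        Set (Module.End ℂ (complexBetti (A.prod A).X 1))) := by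
  have hmem : ∀ φ : A ⟶ A, pullbackOne A φ ∈ Submodule.span ℂ (Set.range fun φ : A ⟶ A ↦ pullbackOne A φ) :=
    fun φ ↦ Submodule.subset_span ⟨φ, rfl⟩
  have e : pullbackOne (A.prod A) ψ =
      (complexBetti.map (AbelianVariety.fst A A).hom.hom.hom 1).hom
          ∘ₗ pullbackOne A (AbelianVariety.prodLift (𝟙 A) (0 : A ⟶ A) ≫ ψ ≫ AbelianVariety.fst A A)
          ∘ₗ (complexBetti.map (AbelianVariety.prodLift (𝟙 A) (0 : A ⟶ A)).hom.hom.hom 1).hom +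
      (complexBetti.map (AbelianVariety.snd A A).hom.hom.hom 1).hom
          ∘ₗ pullbackOne A (AbelianVariety.prodLift (0 : A ⟶ A) (𝟙 A) ≫ ψ ≫ AbelianVariety.fst A A)
          ∘ₗ (complexBetti.map (AbelianVariety.prodLift (𝟙 A) (0 : A ⟶ A)).hom.hom.hom 1).hom +
      (complexBetti.map (AbelianVariety.fst A A).hom.hom.hom 1).hom
          ∘ₗ pullbackOne A (AbelianVariety.prodLift (𝟙 A) (0 : A ⟶ A) ≫ ψ ≫ AbelianVariety.snd A A)
          ∘ₗ (complexBetti.map (AbelianVariety.prodLift (0 : A ⟶ A) (𝟙 A)).hom.hom.hom 1).hom +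
      (complexBetti.map (AbelianVariety.snd A A).hom.hom.hom 1).hom
          ∘ₗ pullbackOne A (AbelianVariety.prodLift (0 : A ⟶ A) (𝟙 A) ≫ ψ ≫ AbelianVariety.snd A A)
          ∘ₗ (complexBetti.map (AbelianVariety.prodLift (0 : A ⟶ A) (𝟙 A)).hom.hom.hom 1).hom :=
    LinearMap.ext fun x ↦ pullbackOne_prod_apply_eq_sum ψ x
  rw [e]
  refine Subalgebra.add_mem _ (Subalgebra.add_mem _ (Subalgebra.add_mem _ ?_ ?_) ?_) ?_
  · exact (block_mem_adjoin_symmetricPullbackSpan_prod hA0 hh hnd htop (hmem _)).1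
  · exact (block_mem_adjoin_symmetricPullbackSpan_prod hA0 hh hnd htop (hmem _)).2.2.1
  · exact (block_mem_adjoin_symmetricPullbackSpan_prod hA0 hh hnd htop (hmem _)).2.1
  · exact (block_mem_adjoin_symmetricPullbackSpan_prod hA0 hh hnd htop (hmem _)).2.2.2

/-- **«`B = Mat_m(D)`» for `m = 2`: `B(A × A) ⊗ ℂ = End⁰(A × A) ⊗ ℂ`** — the subalgebra of
`End_ℂ H¹((A × A)(ℂ); ℂ)` generated by `S_λ(A × A) ⊗ ℂ` is, as a subspace, the `ℂ`-span of the pull-backs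
`ψ^*`, `ψ ∈ End(A × A)` (which is a subalgebra: the lane's bicommutant `E''`, `mem_bicommutant_iff_mem_span`).
[cite: MoonenZarhin1998WeilClasses, §1 (chunk p0002 L77–L80; chunk p0003 «B = Mat_m(D)»)]
[cite: Milne1999LefschetzClasses, §1 Remark 1.2 (p. 643)] -/
theorem adjoin_symmetricPullbackSpan_prod_eq_span (hA0 : 0 < A.dim) (hh : h ∈ hodgeClassSpan A.dim A.X 1)
    (hnd : ∀ x : complexBetti A.X 1, (∀ y, polarizationPairingOne A.X h (A.dim - 1) x y = 0) → x = 0)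
    (htop : lefschetzPow h (A.dim - 1) 2 h ≠ 0) :
    Subalgebra.toSubmodule (Algebra.adjoin ℂ
        (symmetricPullbackSpan (A.prod A) (prodPolarizationClass A A h h) :
          Set (Module.End ℂ (complexBetti (A.prod A).X 1)))) =
      Submodule.span ℂ (Set.range fun ψ : A.prod A ⟶ A.prod A ↦ pullbackOne (A.prod A) ψ) := by
  refine le_antisymm ?_ (Submodule.span_le.2 ?_)
  · -- `S_λ ⊗ ℂ ⊆ E''`, a subalgebra, so `adjoin (S_λ ⊗ ℂ) ≤ E''`
    have hle : Algebra.adjoin ℂ (symmetricPullbackSpan (A.prod A) (prodPolarizationClass A A h h) :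
          Set (Module.End ℂ (complexBetti (A.prod A).X 1))) ≤
        Subalgebra.centralizer ℂ (centralizerAlgebra (A.prod A) : Set (Module.End ℂ (complexBetti (A.prod A).X 1))) :=
      Algebra.adjoin_le fun T hT ↦ mem_bicommutant_iff_mem_span.2 (symmetricPullbackSpan_le_span hT)
    intro T hT
    exact mem_bicommutant_iff_mem_span.1 (hle ((Subalgebra.mem_toSubmodule _).1 hT))
  · rintro _ ⟨ψ, rfl⟩
    exact pullbackOne_prod_mem_adjoin_symmetricPullbackSpan hA0 hh hnd htop ψ

/-- **Moonen–Zarhin 1998, §1: «`G_div(X)` is the centralizer of `Δ` in `SP(V_Y, φ_Y)`, embedded diagonally … if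
`m ≥ 2` … `Δ = D`», for `m = 2`, on the carrier: `G_div(A × A)(ℂ) = S(A × A)(ℂ)`.** For a complex abelian variety
`A` of positive dimension and `h ∈ B¹(A) ⊗ ℂ` with `Q_h` non-degenerate and `h^{dim A} ≠ 0`, Moonen–Zarhin's
group of the self-product for the product polarization class `H = pr₁^* h + pr₂^* h` — the automorphisms of
`H¹((A × A)(ℂ); ℂ)` commuting with `S_λ(A × A) ⊗ ℂ` and preserving `Q_H` — coincides with Milne's `S(A × A)(H)(ℂ)`,
the automorphisms commuting with EVERY `ψ^*`, `ψ ∈ End(A × A)`, and preserving `Q_H`.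
[cite: MoonenZarhin1998WeilClasses, §1 (chunk p0002 L68–L80)] [cite: Milne1999LefschetzClasses, §1 p. 644] -/
theorem divisorLefschetzGroup_prod_eq_unitaryCentralizerGroup (hA0 : 0 < A.dim)
    (hh : h ∈ hodgeClassSpan A.dim A.X 1)
    (hnd : ∀ x : complexBetti A.X 1, (∀ y, polarizationPairingOne A.X h (A.dim - 1) x y = 0) → x = 0)
    (htop : lefschetzPow h (A.dim - 1) 2 h ≠ 0) :
    divisorLefschetzGroup (A.prod A) (prodPolarizationClass A A h h) =
      unitaryCentralizerGroup (A.prod A) (prodPolarizationClass A A h h) :=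
  divisorLefschetzGroup_eq_unitaryCentralizerGroup_of_forall_mem_adjoin
    (pullbackOne_prod_mem_adjoin_symmetricPullbackSpan hA0 hh hnd htop)

/-- The same, membership form: `u ∈ G_div(A × A)(H)(ℂ)` iff `u` commutes with every pull-back `ψ^*`,
`ψ ∈ End(A × A)`, and preserves `Q_H`. [cite: MoonenZarhin1998WeilClasses, §1 (chunk p0002 L68–L80)]
[cite: Milne1999LefschetzClasses, §1 p. 644] -/
theorem mem_divisorLefschetzGroup_prod_iff (hA0 : 0 < A.dim) (hh : h ∈ hodgeClassSpan A.dim A.X 1)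
    (hnd : ∀ x : complexBetti A.X 1, (∀ y, polarizationPairingOne A.X h (A.dim - 1) x y = 0) → x = 0)
    (htop : lefschetzPow h (A.dim - 1) 2 h ≠ 0)
    (u : complexBetti (A.prod A).X 1 ≃ₗ[ℂ] complexBetti (A.prod A).X 1) :
    u ∈ divisorLefschetzGroup (A.prod A) (prodPolarizationClass A A h h) ↔
      (∀ (ψ : A.prod A ⟶ A.prod A) (x : complexBetti (A.prod A).X 1),
          u (pullbackOne (A.prod A) ψ x) = pullbackOne (A.prod A) ψ (u x)) ∧
        ∀ x y : complexBetti (A.prod A).X 1,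
          polarizationPairingOne (A.prod A).X (prodPolarizationClass A A h h) ((A.prod A).dim - 1) (u x) (u y) =
            polarizationPairingOne (A.prod A).X (prodPolarizationClass A A h h) ((A.prod A).dim - 1) x y := by
  rw [divisorLefschetzGroup_prod_eq_unitaryCentralizerGroup hA0 hh hnd htop, mem_unitaryCentralizerGroup_iff,
    mem_centralizerGroup_iff]

end Main

end Literature.AlgebraicGeometry.HodgeTheory

end
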